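import Literature.MathematicalPhysics.QuantumLattice.TorusSectorGibbsScaleCovariance
import Literature.MathematicalPhysics.QuantumLattice.InfVolFermionStateTorusLimitTwoSectorCompanionExistence
import HarnessLib

/-!
# Scale covariance of the two-sector (canonical chemical potential) data: the companion states and the
# partition-function ratios of `H(ct, ct', cU)` at `β` are those of `H(t, t', U)` at `βc`

Topic `Literature/MathematicalPhysics/QuantumLattice`; complement of `TorusSectorGibbsScaleCovariance.lean`
(the thermal object of record — torus limits of the canonical `(rectN n L, S^z = 0)` Gibbs states — is
scale-covariant: `isTorusLimitOfMixture_sectorGibbs_scale_iff`, `_iff_unit`) for the joint data of the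
two-sector energy–entropy balance rows (`…TwoSectorCompanionExistence` & co.): a COMPANION torus limit `ω'` of
the canonical states of another spin sector and the ratio `r = lim Z'/Z` of canonical partition functions
(`βμ_can = log r`). Since `H_L(ct, ct', cU) = c • H_L(t, t', U)` (`hubbardTorusTT'_smul`):

* §1 finite volume, ANY coordinate sector `P`: `Σ_d e^{−β E_d(P; cH)} = Σ_d e^{−βc E_d(P; H)}`
  (`sum_exp_sectorEigenvalue_hubbardTorusTT'_scale`, through `Re Z_β` of the compression — the eigenvalue lists
  of `c • H|_P` and `H|_P` need not be index-wise proportional, the partition sums agree); hence every RATIO of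
  two such sums is scale-covariant (`partitionFn_ratio_hubbardTorusTT'_scale`), in particular the two-sector
  ratios of the «rm↑» / «add↑» / pair templates; unit form `ratio(β; t, t', U) = ratio(βt; 1, t'/t, U/t)` (`partitionFn_ratio_hubbardTorusTT'_eq_unit`);
* §2 the canonical eigen-MIXTURE of any sector is scale-covariant on every torus operator and on every
  translation average (`sum_canonicalWeight_mul_expect_sectorEigenvector_of_eq_smul`,
  `sum_canonicalWeight_mul_torusAvgExpect_sectorEigenvector_of_eq_smul` for `H₁ = c • H₂`: the mixture is the
  Gibbs state of the compression, `Matrix.gibbsState_real_smul`);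
* §3 hence **the companion classes are scale-covariant**: `ω'` is a torus limit of the canonical
  `(a_L, b_L)`-states of `H(ct, ct', cU)` at `β` iff of `H(t, t', U)` at `βc`
  (`isTorusLimitOfMixture_spinSectorCanonical_iff_of_eq_smul` for `H₁ = c • H₂`;
  `isTorusLimitOfMixture_spinSectorGibbs_scale_iff`, `_iff_unit`), and the joint data `(ω, ω', r)` of the
  physical model `H(t, ts, tu)` at `β` are EXACTLY those of the unit model `H(1, s, u)` at `βt`: every two-sector
  word (rows, `r > 0`, brackets on `log r`, energy windows of the companions) certified at `t ≡ 1` as a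
  function of `(s, u, n, β̃)` holds for the physical model at `β = β̃/t`; the canonical chemical potential
  `μ_can = β⁻¹ log r` carries ONE power of `t_eV` (like `μ±` at `T = 0`, `chemPotPlusTT'_eq_mul_unit`).

Everything is PROVED; no definition, no named fact.

## Mathlib / tree search

REUSED: `hubbardTorusTT'_smul`, `Matrix.partitionFn_real_smul`, `Matrix.gibbsState_real_smul`
(`HubbardTTPrimeScaleHomogeneity`), `sum_canonicalWeight_mul_expect_sectorEigenvector_eq_gibbsState`,
`isTorusLimitOfMixture_sectorGibbs_scale_iff` (`TorusSectorGibbsScaleCovariance`),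
`Matrix.IsHermitian.partitionFn_eq_ofReal`, `torusAvgExpectAt_of_injOn` / `_of_not_injOn`, `torusAvgExpect_zero`.
`lean search 'spinSectorGibbs_scale|ratio.*scale'`: nothing (2026-08-27).

## References

* D. Ruelle, *Statistical Mechanics: Rigorous Results* (1969), §3.3 (thermodynamic quantities of a rescaled
  Hamiltonian). [cite: Ruelle1969, §3.3]
* R. B. Israel, *Convexity in the Theory of Lattice Gases* (1979), §I.3 eq. (26). [cite: Israel1979, §I.3 eq. (26)]
* O. Bratteli, D. W. Robinson, *OAQSM 2* (1997), §5.4.2. [cite: BratteliRobinsonII1997, §5.4.2]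
-/

noncomputable section

namespace Literature.MathematicalPhysics.QuantumLattice

open Matrix Finset HubbardWave0 Literature.Probability.LatticeModels ThermodynamicLimit
open _root_.Filter
open scoped _root_.Topology ComplexOrder BigOperators

/-! ### §1 Finite volume: sector partition sums and their ratios -/

section Finite

variable {ι : Type*} [Fintype ι] [DecidableEq ι]

/-- The Boltzmann sum over the eigenvalues of a compression is the real part of its partition function.
[cite: Israel1979, §I.3 eq. (26)] -/
theorem sum_exp_sectorEigenvalue_eq_re_partitionFn (P : ι → Prop) [DecidablePred P] (A : Matrix ι ι ℂ)
    (hA : A.IsHermitian) (β : ℝ) :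
    ∑ d, Real.exp (-(β * sectorEigenvalue P A hA d)) =
      (partitionFn β (A.submatrix (Subtype.val : Subtype P → ι) Subtype.val)).re := by
  rw [(hA.submatrix (Subtype.val : Subtype P → ι)).partitionFn_eq_ofReal, Complex.ofReal_re]
  rfl

/-- **Sector partition sums of a rescaled Hermitian matrix**: if `A₁ = c • A₂` (`c` real) then for every
coordinate sector `P`, `Σ_d e^{−β E_d(P; A₁)} = Σ_d e^{−βc E_d(P; A₂)}` (through `Re Z_β` of the compression —
the two eigenvalue lists need not be index-wise proportional). [cite: Ruelle1969, §3.3] -/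
theorem sum_exp_sectorEigenvalue_of_eq_smul (P : ι → Prop) [DecidablePred P] {A₁ A₂ : Matrix ι ι ℂ}
    (hA₁ : A₁.IsHermitian) (hA₂ : A₂.IsHermitian) {c : ℝ} (h : A₁ = (c : ℂ) • A₂) (β : ℝ) :
    ∑ d, Real.exp (-(β * sectorEigenvalue P A₁ hA₁ d)) =
      ∑ d, Real.exp (-((β * c) * sectorEigenvalue P A₂ hA₂ d)) := by
  rw [sum_exp_sectorEigenvalue_eq_re_partitionFn, sum_exp_sectorEigenvalue_eq_re_partitionFn, h,
    Matrix.submatrix_smul, Pi.smul_apply, Pi.smul_apply, Matrix.partitionFn_real_smul]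

/-- **The canonical eigen-mixture of a sector of a rescaled matrix, on every operator**: if `A₁ = c • A₂` then
`Σ_d w_d(β; A₁) ⟨ψ_d(A₁), B ψ_d(A₁)⟩ = Σ_d w_d(βc; A₂) ⟨ψ_d(A₂), B ψ_d(A₂)⟩` (both are the Gibbs state of the
compression, `Matrix.gibbsState_real_smul`; the eigenbases need not coincide). [cite: Ruelle1969, §3.3]
[cite: Israel1979, §I.3 eq. (26)] -/
theorem sum_canonicalWeight_mul_expect_sectorEigenvector_of_eq_smul (P : ι → Prop) [DecidablePred P]
    {A₁ A₂ : Matrix ι ι ℂ} (hA₁ : A₁.IsHermitian) (hA₂ : A₂.IsHermitian) {c : ℝ} (h : A₁ = (c : ℂ) • A₂)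
    (β : ℝ) (B : Matrix ι ι ℂ) :
    ∑ d, (canonicalWeight β (sectorEigenvalue P A₁ hA₁) d : ℂ) *
        (star (sectorEigenvector P A₁ hA₁ d) ⬝ᵥ (B *ᵥ sectorEigenvector P A₁ hA₁ d)) =
      ∑ d, (canonicalWeight (β * c) (sectorEigenvalue P A₂ hA₂) d : ℂ) *
        (star (sectorEigenvector P A₂ hA₂ d) ⬝ᵥ (B *ᵥ sectorEigenvector P A₂ hA₂ d)) := by
  rw [sum_canonicalWeight_mul_expect_sectorEigenvector_eq_gibbsState,
    sum_canonicalWeight_mul_expect_sectorEigenvector_eq_gibbsState]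
  subst h
  rw [Matrix.submatrix_smul, Pi.smul_apply, Pi.smul_apply, Matrix.gibbsState_real_smul]

end Finite

section Torus

variable (L : ℕ)

/-- **Sector partition sums of the `t–t'` torus are scale-covariant**: for every coordinate sector `P`,
`Σ_d e^{−β E_d(P; H_L(ct,ct',cU))} = Σ_d e^{−βc E_d(P; H_L(t,t',U))}`. [cite: Ruelle1969, §3.3] -/
theorem sum_exp_sectorEigenvalue_hubbardTorusTT'_scale (P : Finset (Orb (FermionTorus 2 L)) → Prop)
    [DecidablePred P] (β c t t' U : ℝ) :
    ∑ d, Real.exp (-(β * sectorEigenvalue P (hubbardTorusTT' L (c * t) (c * t') (c * U))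
        (hubbardTorusTT'_isHermitian L (c * t) (c * t') (c * U)) d)) =
      ∑ d, Real.exp (-((β * c) * sectorEigenvalue P (hubbardTorusTT' L t t' U)
        (hubbardTorusTT'_isHermitian L t t' U) d)) := by
  classical
  exact sum_exp_sectorEigenvalue_of_eq_smul P _ _ (hubbardTorusTT'_smul L c t t' U) β

/-- **Ratios of sector partition sums are scale-covariant** (any two sectors `P`, `P'`): the two-sector ratio
`Z_{P'}/Z_P` of `H_L(ct, ct', cU)` at `β` equals that of `H_L(t, t', U)` at `βc`. [cite: Ruelle1969, §3.3]
[cite: BratteliRobinsonII1997, §5.4.2] -/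
theorem partitionFn_ratio_hubbardTorusTT'_scale (P P' : Finset (Orb (FermionTorus 2 L)) → Prop)
    [DecidablePred P] [DecidablePred P'] (β c t t' U : ℝ) :
    (∑ d, Real.exp (-(β * sectorEigenvalue P' (hubbardTorusTT' L (c * t) (c * t') (c * U))
        (hubbardTorusTT'_isHermitian L (c * t) (c * t') (c * U)) d))) /
      (∑ d, Real.exp (-(β * sectorEigenvalue P (hubbardTorusTT' L (c * t) (c * t') (c * U))
        (hubbardTorusTT'_isHermitian L (c * t) (c * t') (c * U)) d))) =
    (∑ d, Real.exp (-((β * c) * sectorEigenvalue P' (hubbardTorusTT' L t t' U)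
        (hubbardTorusTT'_isHermitian L t t' U) d))) /
      (∑ d, Real.exp (-((β * c) * sectorEigenvalue P (hubbardTorusTT' L t t' U)
        (hubbardTorusTT'_isHermitian L t t' U) d))) := by
  rw [sum_exp_sectorEigenvalue_hubbardTorusTT'_scale, sum_exp_sectorEigenvalue_hubbardTorusTT'_scale]

/-- `H_L(t, t', U) = t • H_L(1, t'/t, U/t)` for `t ≠ 0`. [cite: XuEtAl2024, eq. (1)] -/
theorem hubbardTorusTT'_eq_smul_unit {t : ℝ} (ht : t ≠ 0) (t' U : ℝ) :
    hubbardTorusTT' L t t' U = (t : ℂ) • hubbardTorusTT' L 1 (t' / t) (U / t) := by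
  have h := hubbardTorusTT'_smul L t 1 (t' / t) (U / t)
  rwa [mul_one, mul_div_cancel₀ _ ht, mul_div_cancel₀ _ ht] at h

/-- **Unit form**: the two-sector ratio of the physical model `H_L(t, t', U)` at `β` is that of the unit model
`H_L(1, t'/t, U/t)` at `βt` (`t ≠ 0`) — the canonical chemical potential `β⁻¹ log r` carries one power of `t`.
[cite: Ruelle1969, §3.3] -/
theorem partitionFn_ratio_hubbardTorusTT'_eq_unit (P P' : Finset (Orb (FermionTorus 2 L)) → Prop)
    [DecidablePred P] [DecidablePred P'] (β : ℝ) {t : ℝ} (ht : t ≠ 0) (t' U : ℝ) :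
    (∑ d, Real.exp (-(β * sectorEigenvalue P' (hubbardTorusTT' L t t' U) (hubbardTorusTT'_isHermitian L t t' U) d))) /
      (∑ d, Real.exp (-(β * sectorEigenvalue P (hubbardTorusTT' L t t' U) (hubbardTorusTT'_isHermitian L t t' U) d))) =
    (∑ d, Real.exp (-((β * t) * sectorEigenvalue P' (hubbardTorusTT' L 1 (t' / t) (U / t))
        (hubbardTorusTT'_isHermitian L 1 (t' / t) (U / t)) d))) /
      (∑ d, Real.exp (-((β * t) * sectorEigenvalue P (hubbardTorusTT' L 1 (t' / t) (U / t))
        (hubbardTorusTT'_isHermitian L 1 (t' / t) (U / t)) d))) := by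
  classical
  rw [sum_exp_sectorEigenvalue_of_eq_smul P' _ (hubbardTorusTT'_isHermitian L 1 (t' / t) (U / t))
      (hubbardTorusTT'_eq_smul_unit L ht t' U) β,
    sum_exp_sectorEigenvalue_of_eq_smul P _ (hubbardTorusTT'_isHermitian L 1 (t' / t) (U / t))
      (hubbardTorusTT'_eq_smul_unit L ht t' U) β]

/-! ### §2 The canonical eigen-mixture of any sector of the torus is scale-covariant -/

/-- The expectation in a transformed vector is the expectation of the conjugated operator. [folklore] -/
private theorem expect_mulVec_eq_expect_conj' {κ : Type*} [LinearOrder κ] [Fintype κ]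
    (B W : Matrix (Finset κ) (Finset κ) ℂ) (ψ : Fock κ) :
    expect B (W *ᵥ ψ) = expect (Wᴴ * B * W) ψ := by
  unfold expect
  rw [star_mulVec, ← dotProduct_mulVec, mulVec_mulVec, mulVec_mulVec, Matrix.mul_assoc]

/-- **Translation-averaged canonical mixture expectations of any sector are covariant under `H₁ = c • H₂`**
(two Hermitian torus matrices; the terms of the torus-limit predicate). [cite: Ruelle1969, §3.3]
[cite: BratteliRobinsonI1987, §4.3.1 (PDF pp. 373–375)] -/
theorem sum_canonicalWeight_mul_torusAvgExpect_sectorEigenvector_of_eq_smul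
    (P : Finset (Orb (FermionTorus 2 L)) → Prop) [DecidablePred P]
    {H₁ H₂ : Matrix (Finset (Orb (FermionTorus 2 L))) (Finset (Orb (FermionTorus 2 L))) ℂ}
    (hH₁ : H₁.IsHermitian) (hH₂ : H₂.IsHermitian) {c : ℝ} (h : H₁ = (c : ℂ) • H₂) (β : ℝ)
    (Λ : Finset (Site 2)) (A : FermionOp Λ) :
    ∑ d, (canonicalWeight β (sectorEigenvalue P H₁ hH₁) d : ℂ) * torusAvgExpect L Λ A (sectorEigenvector P H₁ hH₁ d) =
      ∑ d, (canonicalWeight (β * c) (sectorEigenvalue P H₂ hH₂) d : ℂ) *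
        torusAvgExpect L Λ A (sectorEigenvector P H₂ hH₂ d) := by
  classical
  rcases Nat.eq_zero_or_pos L with hL | hL
  · subst hL
    simp only [torusAvgExpect_zero, mul_zero, Finset.sum_const_zero]
  haveI : NeZero L := ⟨hL.ne'⟩
  simp_rw [torusAvgExpect_eq]
  by_cases hinj : Set.InjOn (Torus.proj (d := 2) L) ↑Λ
  · simp_rw [torusAvgExpectAt_of_injOn L hinj, Finset.mul_sum, expect_mulVec_eq_expect_conj']
    rw [Finset.sum_comm]
    conv_rhs => rw [Finset.sum_comm]
    refine Finset.sum_congr rfl fun v _ => ?_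
    have key := sum_canonicalWeight_mul_expect_sectorEigenvector_of_eq_smul P hH₁ hH₂ h β
      (((fockTranslate v).val)ᴴ * fermionEmbed (PolySite.toTorusEmb L hinj) A * (fockTranslate v).val)
    unfold expect
    calc ∑ d, (canonicalWeight β (sectorEigenvalue P H₁ hH₁) d : ℂ) *
          (((Fintype.card (TorusSite 2 L) : ℂ))⁻¹ *
            (star (sectorEigenvector P H₁ hH₁ d) ⬝ᵥ
              ((((fockTranslate v).val)ᴴ * fermionEmbed (PolySite.toTorusEmb L hinj) A * (fockTranslate v).val) *ᵥ
                sectorEigenvector P H₁ hH₁ d)))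
        = ((Fintype.card (TorusSite 2 L) : ℂ))⁻¹ *
          ∑ d, (canonicalWeight β (sectorEigenvalue P H₁ hH₁) d : ℂ) *
            (star (sectorEigenvector P H₁ hH₁ d) ⬝ᵥ
              ((((fockTranslate v).val)ᴴ * fermionEmbed (PolySite.toTorusEmb L hinj) A * (fockTranslate v).val) *ᵥ
                sectorEigenvector P H₁ hH₁ d)) := by
          rw [Finset.mul_sum]
          exact Finset.sum_congr rfl fun i _ => by ring
      _ = ((Fintype.card (TorusSite 2 L) : ℂ))⁻¹ *
          ∑ d, (canonicalWeight (β * c) (sectorEigenvalue P H₂ hH₂) d : ℂ) *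
            (star (sectorEigenvector P H₂ hH₂ d) ⬝ᵥ
              ((((fockTranslate v).val)ᴴ * fermionEmbed (PolySite.toTorusEmb L hinj) A * (fockTranslate v).val) *ᵥ
                sectorEigenvector P H₂ hH₂ d)) := by rw [key]
      _ = _ := by
          rw [Finset.mul_sum]
          exact Finset.sum_congr rfl fun i _ => by ring
  · simp_rw [torusAvgExpectAt_of_not_injOn L hinj, mul_zero]

end Torus

/-! ### §3 The companion classes are scale-covariant -/

namespace InfVolFermionState

/-- **Torus limits of spin-sector canonical states of two proportional Hamiltonian families coincide up to
`β ↦ βc`.** If `H₁(L) = c • H₂(L)` for all `L` (Hermitian torus matrices), then `ω` is a torus limit of the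
canonical `(a_L, b_L)`-eigen-mixtures (standard presentation) of `H₁` at `β` along `Ls` iff of `H₂` at `βc`.
[cite: Ruelle1969, §3.3] [cite: BratteliRobinsonI1987, §4.3.1 (PDF pp. 373–375)] -/
theorem isTorusLimitOfMixture_spinSectorCanonical_iff_of_eq_smul (ω : InfVolFermionState 2) (β c : ℝ)
    {H₁ H₂ : ∀ L : ℕ, Matrix (Finset (Orb (FermionTorus 2 L))) (Finset (Orb (FermionTorus 2 L))) ℂ}
    (hH₁ : ∀ L, (H₁ L).IsHermitian) (hH₂ : ∀ L, (H₂ L).IsHermitian) (h : ∀ L, H₁ L = (c : ℂ) • H₂ L)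
    (a b : ℕ → ℕ) (Ls : ℕ → ℕ) :
    ω.IsTorusLimitOfMixture
        (fun L => Fintype.card (Subtype (spinConfig (Λ := FermionTorus 2 L) (a L) (b L))))
        (fun L i => canonicalWeight β (sectorEigenvalue (spinConfig (a L) (b L)) (H₁ L) (hH₁ L))
          ((Fintype.equivFin _).symm i))
        (fun L i => sectorEigenvector (spinConfig (a L) (b L)) (H₁ L) (hH₁ L) ((Fintype.equivFin _).symm i)) Ls ↔
      ω.IsTorusLimitOfMixture
        (fun L => Fintype.card (Subtype (spinConfig (Λ := FermionTorus 2 L) (a L) (b L))))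
        (fun L i => canonicalWeight (β * c) (sectorEigenvalue (spinConfig (a L) (b L)) (H₂ L) (hH₂ L))
          ((Fintype.equivFin _).symm i))
        (fun L i => sectorEigenvector (spinConfig (a L) (b L)) (H₂ L) (hH₂ L) ((Fintype.equivFin _).symm i)) Ls := by
  have hkey : ∀ (L : ℕ) (Λ : Finset (Site 2)) (A : FermionOp Λ),
      ∑ i : Fin (Fintype.card (Subtype (spinConfig (Λ := FermionTorus 2 L) (a L) (b L)))),
        (canonicalWeight β (sectorEigenvalue (spinConfig (a L) (b L)) (H₁ L) (hH₁ L))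
          ((Fintype.equivFin _).symm i) : ℂ) *
        torusAvgExpect L Λ A (sectorEigenvector (spinConfig (a L) (b L)) (H₁ L) (hH₁ L) ((Fintype.equivFin _).symm i)) =
      ∑ i : Fin (Fintype.card (Subtype (spinConfig (Λ := FermionTorus 2 L) (a L) (b L)))),
        (canonicalWeight (β * c) (sectorEigenvalue (spinConfig (a L) (b L)) (H₂ L) (hH₂ L))
          ((Fintype.equivFin _).symm i) : ℂ) *
        torusAvgExpect L Λ A (sectorEigenvector (spinConfig (a L) (b L)) (H₂ L) (hH₂ L) ((Fintype.equivFin _).symm i)) := by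
    intro L Λ A
    rw [Equiv.sum_comp (Fintype.equivFin _).symm (fun d => (canonicalWeight β (sectorEigenvalue
        (spinConfig (a L) (b L)) (H₁ L) (hH₁ L)) d : ℂ) *
        torusAvgExpect L Λ A (sectorEigenvector (spinConfig (a L) (b L)) (H₁ L) (hH₁ L) d)),
      Equiv.sum_comp (Fintype.equivFin _).symm (fun d => (canonicalWeight (β * c) (sectorEigenvalue
        (spinConfig (a L) (b L)) (H₂ L) (hH₂ L)) d : ℂ) *
        torusAvgExpect L Λ A (sectorEigenvector (spinConfig (a L) (b L)) (H₂ L) (hH₂ L) d))]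
    exact sum_canonicalWeight_mul_torusAvgExpect_sectorEigenvector_of_eq_smul L _ (hH₁ L) (hH₂ L) (h L) β Λ A
  simp only [InfVolFermionState.IsTorusLimitOfMixture, hkey]

/-- **Torus limits of spin-sector canonical states are scale-covariant.** For every real `c`, all spin-sector
sequences `(a_L, b_L)` and every `Ls`: `ω'` is a torus limit of the canonical eigen-mixtures (standard
presentation) of `hubbardTorusTT' L (ct) (ct') (cU)` at inverse temperature `β` on `(a_L, b_L)` iff it is one of
`hubbardTorusTT' L t t' U` at `βc` — the companion classes of the two-sector rows transform exactly like the
object of record (`isTorusLimitOfMixture_sectorGibbs_scale_iff`). [cite: Ruelle1969, §3.3]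
[cite: BratteliRobinsonI1987, §4.3.1 (PDF pp. 373–375)] -/
theorem isTorusLimitOfMixture_spinSectorGibbs_scale_iff (ω : InfVolFermionState 2) (β c t t' U : ℝ)
    (a b : ℕ → ℕ) (Ls : ℕ → ℕ) :
    ω.IsTorusLimitOfMixture
        (fun L => Fintype.card (Subtype (spinConfig (Λ := FermionTorus 2 L) (a L) (b L))))
        (fun L i => canonicalWeight β (sectorEigenvalue (spinConfig (a L) (b L))
          (hubbardTorusTT' L (c * t) (c * t') (c * U)) (hubbardTorusTT'_isHermitian L (c * t) (c * t') (c * U)))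
          ((Fintype.equivFin _).symm i))
        (fun L i => sectorEigenvector (spinConfig (a L) (b L)) (hubbardTorusTT' L (c * t) (c * t') (c * U))
          (hubbardTorusTT'_isHermitian L (c * t) (c * t') (c * U)) ((Fintype.equivFin _).symm i)) Ls ↔
      ω.IsTorusLimitOfMixture
        (fun L => Fintype.card (Subtype (spinConfig (Λ := FermionTorus 2 L) (a L) (b L))))
        (fun L i => canonicalWeight (β * c) (sectorEigenvalue (spinConfig (a L) (b L)) (hubbardTorusTT' L t t' U)
          (hubbardTorusTT'_isHermitian L t t' U)) ((Fintype.equivFin _).symm i))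
        (fun L i => sectorEigenvector (spinConfig (a L) (b L)) (hubbardTorusTT' L t t' U)
          (hubbardTorusTT'_isHermitian L t t' U) ((Fintype.equivFin _).symm i)) Ls :=
  isTorusLimitOfMixture_spinSectorCanonical_iff_of_eq_smul ω β c
    (fun L => hubbardTorusTT'_isHermitian L (c * t) (c * t') (c * U)) (fun L => hubbardTorusTT'_isHermitian L t t' U)
    (fun L => hubbardTorusTT'_smul L c t t' U) a b Ls

/-- **Unit form for the companions**: `ω'` is a torus limit of the canonical `(a_L, b_L)`-states of the
physical model `H(t, t', U)` at `β` iff of the UNIT model `H(1, t'/t, U/t)` at `βt` (`t ≠ 0`). Together with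
`isTorusLimitOfMixture_sectorGibbs_iff_unit` and `partitionFn_ratio_hubbardTorusTT'_eq_unit`: the joint data
`(ω, ω', r)` of the two-sector rows of the physical model at `β` are exactly those of the unit model at `βt`, so
every two-sector word certified at `t ≡ 1` in `(t'/t, U/t, n, β̃)` holds for the physical model at `β = β̃/t`.
[cite: Ruelle1969, §3.3] -/
theorem isTorusLimitOfMixture_spinSectorGibbs_iff_unit (ω : InfVolFermionState 2) (β : ℝ) {t : ℝ}
    (ht : t ≠ 0) (t' U : ℝ) (a b : ℕ → ℕ) (Ls : ℕ → ℕ) :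
    ω.IsTorusLimitOfMixture
        (fun L => Fintype.card (Subtype (spinConfig (Λ := FermionTorus 2 L) (a L) (b L))))
        (fun L i => canonicalWeight β (sectorEigenvalue (spinConfig (a L) (b L)) (hubbardTorusTT' L t t' U)
          (hubbardTorusTT'_isHermitian L t t' U)) ((Fintype.equivFin _).symm i))
        (fun L i => sectorEigenvector (spinConfig (a L) (b L)) (hubbardTorusTT' L t t' U)
          (hubbardTorusTT'_isHermitian L t t' U) ((Fintype.equivFin _).symm i)) Ls ↔
      ω.IsTorusLimitOfMixture
        (fun L => Fintype.card (Subtype (spinConfig (Λ := FermionTorus 2 L) (a L) (b L))))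
        (fun L i => canonicalWeight (β * t) (sectorEigenvalue (spinConfig (a L) (b L))
          (hubbardTorusTT' L 1 (t' / t) (U / t)) (hubbardTorusTT'_isHermitian L 1 (t' / t) (U / t)))
          ((Fintype.equivFin _).symm i))
        (fun L i => sectorEigenvector (spinConfig (a L) (b L)) (hubbardTorusTT' L 1 (t' / t) (U / t))
          (hubbardTorusTT'_isHermitian L 1 (t' / t) (U / t)) ((Fintype.equivFin _).symm i)) Ls :=
  isTorusLimitOfMixture_spinSectorCanonical_iff_of_eq_smul ω β t
    (fun L => hubbardTorusTT'_isHermitian L t t' U) (fun L => hubbardTorusTT'_isHermitian L 1 (t' / t) (U / t))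
    (fun L => hubbardTorusTT'_eq_smul_unit L ht t' U) a b Ls

end InfVolFermionState

end Literature.MathematicalPhysics.QuantumLattice

end
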